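import Summits.QuantumFields.YangMills.Theorems.ColdStartUniversalityLatticeLangevinLatitudeAlgebra
import Literature.MathematicalPhysics.QuantumFieldTheory.SUNBakryEmeryFrameConjugation
import HarnessLib

/-!
# Route `ColdStartUniversality` (fixed-cut-off package): the SZZ noise directions `𝐩(E_n)` and the Bakry–Émery Parseval frame
# `(Y_α)` of `𝔰𝔲(2)` give THE SAME sums of squares — the linear-algebra heart of the one-link dictionary
# «CSU carré du champ = 2 · SUNBakryEmery.Gam»

Helper file (seat `ym-line-csu-p1`, g21; `--supports stmt-QuantumFields-27363`).  The SZZ lattice Langevin dynamics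
(`latticeLangevinDynamics`) drives each link by the noise fields `√2·𝐩(E_n)·Q`, `n ∈ NoiseIdx 2`, `E_n = noiseDir n` the canonical
orthonormal basis of `(M_2(ℂ), Re tr(XYᴴ))`, `𝐩 = lieProj` the orthogonal projection onto `𝔰𝔲(2)`; the Bakry–Émery files
(`Literature…SUNBakryEmery*`, g19/g20: Poincaré and LOG-SOBOLEV inequalities for Haar) use the Parseval frame `(Y_α)` of `𝔰𝔲(N)` and
left-invariant derivatives `dF(Q)[QY_α]`.

* ★ `sum_sq_apply_lieProj_noiseDir` — for every real-linear functional `λ` on `M_2(ℂ)`: `∑_n λ(𝐩 E_n)² = ∑_α λ(Y_α)²` (both are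
  `‖R‖²_HS` for the Riesz representer `R ∈ 𝔰𝔲(2)` of `λ|_{𝔰𝔲(2)}`: completeness of `(E_n)` + orthogonality of `𝐩`, resp. the frame
  Parseval identity `frobNorm_frameGrad_sq`);
* ★★ `sum_sq_apply_noise_eq_two_mul_sum_sq_apply_mul_frame` — for unitary `Q`: `∑_n λ(√2·𝐩(E_n)·Q)² = 2 ∑_α λ(Q·Y_α)²`
  (with `Literature…SUNBakryEmery.sum_sq_apply_frame_mul_eq_sum_sq_apply_mul_frame`, the left/right conversion): applied to
  `λ = dũ(Q_e)` this says that the second-order (noise) part of the CSU coordinate generator on link `e` has carré du champ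
  `2·Gam(ũ)(Q_e)` — the remaining step to the one-link dictionary is real-coordinate chain-rule bookkeeping.

THEOREMS ONLY, no definition, no sorry.  RECORD-rung R3 plumbing; nothing here bears on the Yang–Mills mass gap.
-/

set_option autoImplicit false

noncomputable section

namespace Summit.QuantumFields.YangMills.Theorems.ColdStartUniversality

open scoped Matrix ComplexConjugate BigOperators
open Matrix Complex Finset
open Literature.MathematicalPhysics.QuantumFieldTheory
open Literature.MathematicalPhysics.QuantumLattice (fundamentalRep fundamentalLatticeRep continuous_fundamentalRep)

/-- ★ **Noise basis vs. Parseval frame**: for every real-linear functional `λ` on `M_2(ℂ)`,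
`∑_{n} λ(𝐩 E_n)² = ∑_α λ(Y_α)²` (`𝐩 = lieProj` of the fundamental `SU(2)` datum, `E_n = noiseDir n`, `Y_α = SUNBakryEmery.frame α`).
[cite: ShenZhuZhu2022, §3 (before Lemma 3.1: `C_𝔤 = Σ_a v_a²` is basis independent)] -/
theorem sum_sq_apply_lieProj_noiseDir (lam : Matrix (Fin (fundamentalLatticeRep 2).N) (Fin (fundamentalLatticeRep 2).N) ℂ →ₗ[ℝ] ℝ) :
    ∑ n : NoiseIdx 2, lam ((fundamentalLatticeRep 2).lieProj (noiseDir n)) ^ 2 =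
      ∑ α : SUNBakryEmery.FrameIdx (fundamentalLatticeRep 2).N, lam (SUNBakryEmery.frame α) ^ 2 := by
  have hN : (fundamentalLatticeRep 2).N ≠ 0 := two_ne_zero
  -- `ν = λ ∘ 𝐩` and its Riesz representer `R = Σ_n ν(E_n) E_n`
  set ν : Matrix (Fin (fundamentalLatticeRep 2).N) (Fin (fundamentalLatticeRep 2).N) ℂ →ₗ[ℝ] ℝ := lam.comp (fundamentalLatticeRep 2).lieProj with hν
  have hν_apply : ∀ X, ν X = lam ((fundamentalLatticeRep 2).lieProj X) := fun X => rfl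
  set R : Matrix (Fin (fundamentalLatticeRep 2).N) (Fin (fundamentalLatticeRep 2).N) ℂ := ∑ n : NoiseIdx (fundamentalLatticeRep 2).N, ν (noiseDir n) • noiseDir n with hR
  -- (A) `ν X = ⟨X, R⟩`
  have hA : ∀ X : Matrix (Fin (fundamentalLatticeRep 2).N) (Fin (fundamentalLatticeRep 2).N) ℂ, ν X = hsForm (fundamentalLatticeRep 2).N X R := by
    intro X
    have hX := sum_hsForm_noiseDir_smul X
    calc ν X = ν (∑ n : NoiseIdx (fundamentalLatticeRep 2).N, hsForm (fundamentalLatticeRep 2).N X (noiseDir n) • noiseDir n) := by rw [hX]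
      _ = ∑ n : NoiseIdx (fundamentalLatticeRep 2).N, hsForm (fundamentalLatticeRep 2).N X (noiseDir n) * ν (noiseDir n) := by
          rw [map_sum]; exact sum_congr rfl fun n _ => by rw [map_smul, smul_eq_mul]
      _ = ∑ n : NoiseIdx (fundamentalLatticeRep 2).N, ν (noiseDir n) * hsForm (fundamentalLatticeRep 2).N X (noiseDir n) := sum_congr rfl fun n _ => mul_comm _ _
      _ = hsForm (fundamentalLatticeRep 2).N X R := by
          rw [hR, map_sum]; exact sum_congr rfl fun n _ => by rw [map_smul, smul_eq_mul]
  -- (B) `Σ_n ν(E_n)² = ⟨R, R⟩`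
  have hB : ∑ n : NoiseIdx (fundamentalLatticeRep 2).N, ν (noiseDir n) ^ 2 = hsForm (fundamentalLatticeRep 2).N R R := by
    rw [← hA R, hR, map_sum]
    exact sum_congr rfl fun n _ => by rw [map_smul, smul_eq_mul, sq]
  -- (C) `R ∈ 𝔤`: `D = R − 𝐩R` has `⟨D, D⟩ = 0`
  have hRmem : R ∈ (fundamentalLatticeRep 2).lieAlg := by
    set D : Matrix (Fin (fundamentalLatticeRep 2).N) (Fin (fundamentalLatticeRep 2).N) ℂ := R - (fundamentalLatticeRep 2).lieProj R with hD
    have h1 : hsForm (fundamentalLatticeRep 2).N D R = 0 := by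
      rw [← hA D, hν_apply, hD, map_sub, (fundamentalLatticeRep 2).lieProj_of_mem ((fundamentalLatticeRep 2).lieProj_mem R), sub_self, map_zero]
    have h2 : hsForm (fundamentalLatticeRep 2).N D ((fundamentalLatticeRep 2).lieProj R) = 0 := by
      rw [hsForm_comm]; exact (fundamentalLatticeRep 2).hsForm_sub_lieProj ((fundamentalLatticeRep 2).lieProj_mem R)
    have h3 : hsForm (fundamentalLatticeRep 2).N D D = 0 := by
      have : hsForm (fundamentalLatticeRep 2).N D D = hsForm (fundamentalLatticeRep 2).N D R - hsForm (fundamentalLatticeRep 2).N D ((fundamentalLatticeRep 2).lieProj R) := by rw [hD, map_sub]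
      rw [this, h1, h2, sub_zero]
    have hD0 : D = 0 := hsForm_self_eq_zero.1 h3
    have : R = (fundamentalLatticeRep 2).lieProj R := sub_eq_zero.1 (by rw [← hD]; exact hD0)
    rw [this]; exact (fundamentalLatticeRep 2).lieProj_mem R
  -- (D) the frame side: `Z = frameGrad λ ∈ 𝔰𝔲(2)`, `λ X = ⟨X, Z⟩` on `𝔰𝔲(2)`
  set Z : Matrix (Fin (fundamentalLatticeRep 2).N) (Fin (fundamentalLatticeRep 2).N) ℂ := SUNBakryEmery.frameGrad lam with hZ
  have hZskew : Zᴴ = -Z := SUNBakryEmery.frameGrad_conjTranspose lam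
  have hZ0 : Z.trace = 0 := SUNBakryEmery.frameGrad_trace hN lam
  have hZmem : Z ∈ (fundamentalLatticeRep 2).lieAlg := mem_lieAlg_two_of_star_eq_neg (by rw [star_eq_conjTranspose]; exact hZskew) hZ0
  have hframe : ∑ α : SUNBakryEmery.FrameIdx (fundamentalLatticeRep 2).N, lam (SUNBakryEmery.frame α) ^ 2 = hsForm (fundamentalLatticeRep 2).N Z Z := by
    rw [← SUNBakryEmery.frobNorm_frameGrad_sq hN lam, SUNBakryEmery.frobNorm_sq_of_skew hZskew, hsForm_apply, hZskew,
      Matrix.mul_neg, trace_neg, Complex.neg_re]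
  -- for `X ∈ 𝔤`: `⟨X, R⟩ = λ X = ⟨X, Z⟩`
  have hRZ : ∀ X ∈ (fundamentalLatticeRep 2).lieAlg, hsForm (fundamentalLatticeRep 2).N X R = hsForm (fundamentalLatticeRep 2).N X Z := by
    intro X hX
    have hXskew : Xᴴ = -X := by rw [← star_eq_conjTranspose]; exact (fundamentalLatticeRep 2).star_eq_neg_of_mem_lieAlg hX
    have hXtr : X.trace = 0 := trace_eq_zero_of_mem_lieAlg_two hX
    rw [← hA X, hν_apply, (fundamentalLatticeRep 2).lieProj_of_mem hX, SUNBakryEmery.apply_eq_neg_re_trace_mul_frameGrad hN lam hXskew hXtr,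
      hsForm_apply, ← hZ, hZskew, Matrix.mul_neg, trace_neg, Complex.neg_re]
  -- hence `R = Z`
  have hReq : R = Z := by
    have hmem : R - Z ∈ (fundamentalLatticeRep 2).lieAlg := (fundamentalLatticeRep 2).lieAlg.sub_mem hRmem hZmem
    have h1 : hsForm (fundamentalLatticeRep 2).N (R - Z) (R - Z) = 0 := by
      have e : hsForm (fundamentalLatticeRep 2).N (R - Z) (R - Z) = hsForm (fundamentalLatticeRep 2).N (R - Z) R - hsForm (fundamentalLatticeRep 2).N (R - Z) Z := by rw [map_sub]
      rw [e, hRZ _ hmem, sub_self]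
    exact sub_eq_zero.1 (hsForm_self_eq_zero.1 h1)
  -- conclude
  calc ∑ n : NoiseIdx 2, lam ((fundamentalLatticeRep 2).lieProj (noiseDir n)) ^ 2 = ∑ n : NoiseIdx (fundamentalLatticeRep 2).N, ν (noiseDir n) ^ 2 :=
        sum_congr rfl fun n _ => by rw [hν_apply]
    _ = hsForm (fundamentalLatticeRep 2).N R R := hB
    _ = hsForm (fundamentalLatticeRep 2).N Z Z := by rw [hReq]
    _ = ∑ α : SUNBakryEmery.FrameIdx (fundamentalLatticeRep 2).N, lam (SUNBakryEmery.frame α) ^ 2 := hframe.symm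

/-- ★★ **SZZ noise fields vs. left-invariant frame fields**: for every real-linear functional `λ` on `M_2(ℂ)` and every unitary `Q`
(`QQᴴ = QᴴQ = 1`), `∑_n λ(√2·𝐩(E_n)·Q)² = 2 ∑_α λ(Q·Y_α)²`.  With `λ = dũ(Q)` (the differential of an ambient extension of a link
observable): the carré du champ of the SZZ noise `Σ_n (dũ[√2𝐩(E_n)Q])²` is `2·Γ(ũ,ũ)(Q) = 2 Σ_α (D_α ũ)²` of the Bakry–Émery files.
[cite: ShenZhuZhu2022, §3 Lemma 3.1 and (1.6) (noise `√2 dB∘Q`, `B = 𝐩(𝓦)`)] -/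
theorem sum_sq_apply_noise_eq_two_mul_sum_sq_apply_mul_frame (lam : Matrix (Fin (fundamentalLatticeRep 2).N) (Fin (fundamentalLatticeRep 2).N) ℂ →ₗ[ℝ] ℝ)
    {Q : Matrix (Fin (fundamentalLatticeRep 2).N) (Fin (fundamentalLatticeRep 2).N) ℂ} (hQ : Q * Qᴴ = 1) (hQ' : Qᴴ * Q = 1) :
    ∑ n : NoiseIdx 2, lam ((Real.sqrt 2 : ℂ) • ((fundamentalLatticeRep 2).lieProj (noiseDir n) * Q)) ^ 2 =
      2 * ∑ α : SUNBakryEmery.FrameIdx (fundamentalLatticeRep 2).N, lam (Q * SUNBakryEmery.frame α) ^ 2 := by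
  have hN : (fundamentalLatticeRep 2).N ≠ 0 := two_ne_zero
  -- `λ_Q(X) = λ(XQ)` is real-linear
  set lamQ : Matrix (Fin (fundamentalLatticeRep 2).N) (Fin (fundamentalLatticeRep 2).N) ℂ →ₗ[ℝ] ℝ := lam.comp (LinearMap.mulRight ℝ Q) with hlamQ
  have hlamQ_apply : ∀ X, lamQ X = lam (X * Q) := fun X => rfl
  -- pull out `√2`: `λ(√2 • M) = √2 λ(M)`
  have hsmul : ∀ M : Matrix (Fin (fundamentalLatticeRep 2).N) (Fin (fundamentalLatticeRep 2).N) ℂ, lam ((Real.sqrt 2 : ℂ) • M) = Real.sqrt 2 * lam M := by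
    intro M
    have : ((Real.sqrt 2 : ℂ) • M) = (Real.sqrt 2 : ℝ) • M := by
      rw [← Complex.coe_smul]
    rw [this, map_smul, smul_eq_mul]
  have h2 : Real.sqrt 2 ^ 2 = 2 := Real.sq_sqrt (by norm_num)
  calc ∑ n : NoiseIdx 2, lam ((Real.sqrt 2 : ℂ) • ((fundamentalLatticeRep 2).lieProj (noiseDir n) * Q)) ^ 2
      = ∑ n : NoiseIdx 2, 2 * lamQ ((fundamentalLatticeRep 2).lieProj (noiseDir n)) ^ 2 := by
        refine sum_congr rfl fun n _ => ?_
        rw [hsmul, hlamQ_apply, mul_pow, h2]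
    _ = 2 * ∑ n : NoiseIdx 2, lamQ ((fundamentalLatticeRep 2).lieProj (noiseDir n)) ^ 2 := by rw [mul_sum]
    _ = 2 * ∑ α : SUNBakryEmery.FrameIdx (fundamentalLatticeRep 2).N, lamQ (SUNBakryEmery.frame α) ^ 2 := by
        rw [sum_sq_apply_lieProj_noiseDir]
    _ = 2 * ∑ α : SUNBakryEmery.FrameIdx (fundamentalLatticeRep 2).N, lam (SUNBakryEmery.frame α * Q) ^ 2 := by
        congr 1
    _ = 2 * ∑ α : SUNBakryEmery.FrameIdx (fundamentalLatticeRep 2).N, lam (Q * SUNBakryEmery.frame α) ^ 2 := by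
        rw [SUNBakryEmery.sum_sq_apply_frame_mul_eq_sum_sq_apply_mul_frame hN lam hQ hQ']

end Summit.QuantumFields.YangMills.Theorems.ColdStartUniversality

end
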